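import Summits.Ventures.HodgeRepro2.T5HeckeProductDoubleCosets
import Summits.Ventures.HodgeRepro2.T5HeckeDoubleCoset

/-!
# The Hecke operators of `G × H` on an external tensor product `π ⊠ σ`

Kernel annex of the Tier-5 record (blind lane).  The dual pair of the record is a product
`G × H` with `K = K_G × K_H`, and its representations are external tensor products `π ⊠ σ`.  With
`T5HeckeProductDoubleCosets` (the double cosets of `K_G × K_H` are products):

* `extProd ρ σ : Representation k (G × H) (V ⊗ W)`, `(g, h) ↦ ρ g ⊗ σ h`;
* `tmul_mem_invariants` — `v ⊗ w` is `K_G × K_H`-fixed when `v ∈ π^{K_G}`, `w ∈ σ^{K_H}`;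
* `heckeSMul_doubleCosetOp_tmul` — **`T_{(g,h)} (v ⊗ w) = T_g v ⊗ T_h w`**: the Hecke operator
  of the product acts on pure tensors of spherical vectors factorwise (`T_g = 1_{KgK}` of
  `T5HeckeDoubleCoset`), so the Hecke eigenvalues of `π ⊠ σ` are the products of those of `π`
  and `σ` (`heckeSMul_doubleCosetOp_tmul_eq_smul`).

What stays prose: the identification of the record's representations of `U(V_v) × U(W_v)` with
such external tensor products; the printed theorems.
-/

namespace Summit.Ventures.HodgeRepro2.T5HeckeExternalTensor

open T5HeckePermutationModule T5HeckeDoubleCoset T5HeckeProductDoubleCosets LevelPositivity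
open scoped TensorProduct

variable {G : Type*} [Group G] {H : Type*} [Group H] {k : Type*} [Field k]
  {V : Type*} [AddCommGroup V] [Module k V] {W : Type*} [AddCommGroup W] [Module k W]
  (ρ : Representation k G V) (σ : Representation k H W)

/-- The external tensor product `π ⊠ σ` of representations of `G` and `H`, a representation of
`G × H` on `V ⊗ W`. -/
noncomputable def extProd : Representation k (G × H) (V ⊗[k] W) :=
  Representation.tprod (ρ.comp (MonoidHom.fst G H) : Representation k (G × H) V)
    (σ.comp (MonoidHom.snd G H) : Representation k (G × H) W)

/-- `(π ⊠ σ)(g, h) (v ⊗ w) = π(g) v ⊗ σ(h) w`. -/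
theorem extProd_apply_tmul (g : G) (h : H) (v : V) (w : W) :
    extProd ρ σ (g, h) (v ⊗ₜ[k] w) = ρ g v ⊗ₜ[k] σ h w := by
  simp only [extProd, Representation.tprod_apply, TensorProduct.map_tmul, MonoidHom.comp_apply,
    MonoidHom.coe_fst, MonoidHom.coe_snd]

variable {A : Subgroup G} {B : Subgroup H}

/-- A pure tensor of `K_G`- and `K_H`-fixed vectors is `K_G × K_H`-fixed. -/
theorem tmul_mem_invariants {v : V} (hv : v ∈ invariants ρ A) {w : W} (hw : w ∈ invariants σ B) :
    v ⊗ₜ[k] w ∈ invariants (extProd ρ σ) (A.prod B) := by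
  rw [mem_invariants_iff]
  rintro ⟨a, b⟩ hab
  rw [Subgroup.mem_prod] at hab
  rw [extProd_apply_tmul, mem_invariants_iff.1 hv a hab.1, mem_invariants_iff.1 hw b hab.2]

/-- The orbit map of `v ⊗ w` is the tensor product of the orbit maps, read through `prodEquiv`. -/
theorem orbitMap_extProd {v : V} (hv : v ∈ invariants ρ A) {w : W} (hw : w ∈ invariants σ B)
    (x : (G × H) ⧸ A.prod B) :
    orbitMap (extProd ρ σ) (v ⊗ₜ[k] w) (tmul_mem_invariants ρ σ hv hw) x =
      orbitMap ρ v hv (QuotientGroup.prodEquiv A B x).1 ⊗ₜ[k]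
        orbitMap σ w hw (QuotientGroup.prodEquiv A B x).2 := by
  induction x using QuotientGroup.induction_on with
  | H x =>
    obtain ⟨g, h⟩ := x
    rw [prodEquiv_mk, orbitMap_mk, orbitMap_mk, orbitMap_mk, extProd_apply_tmul]

/-- **`T_{(g, h)} (v ⊗ w) = T_g v ⊗ T_h w`** on `K_G`- and `K_H`-fixed vectors. -/
theorem heckeSMul_doubleCosetOp_tmul (g : G) (h : H)
    [Finite (MulAction.orbit A ((g : G) : G ⧸ A))] [Finite (MulAction.orbit B ((h : H) : H ⧸ B))]
    (v : invariants ρ A) (w : invariants σ B) :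
    haveI := finite_orbit_prod A B g h
    (heckeSMul (extProd ρ σ) (doubleCosetOp k (A.prod B) (g, h))
        ⟨(v : V) ⊗ₜ[k] (w : W), tmul_mem_invariants ρ σ v.2 w.2⟩ : V ⊗[k] W) =
      (heckeSMul ρ (doubleCosetOp k A g) v : V) ⊗ₜ[k] (heckeSMul σ (doubleCosetOp k B h) w : W) := by
  haveI := finite_orbit_prod A B g h
  rw [heckeSMul_doubleCosetOp, heckeSMul_doubleCosetOp, heckeSMul_doubleCosetOp]
  have hbij : Set.BijOn (QuotientGroup.prodEquiv A B)
      (MulAction.orbit (A.prod B) (((g, h) : G × H) : (G × H) ⧸ A.prod B))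
      (MulAction.orbit A ((g : G) : G ⧸ A) ×ˢ MulAction.orbit B ((h : H) : H ⧸ B)) := by
    have := prodEquiv_image_orbit A B (((g, h) : G × H) : (G × H) ⧸ A.prod B)
    rw [prodEquiv_mk] at this
    rw [← this]
    exact (QuotientGroup.prodEquiv A B).injective.injOn.bijOn_image
  rw [finsum_mem_eq_of_bijOn (QuotientGroup.prodEquiv A B) hbij
    (g := fun p : (G ⧸ A) × (H ⧸ B) => orbitMap ρ v v.2 p.1 ⊗ₜ[k] orbitMap σ w w.2 p.2)
    (fun x _ => orbitMap_extProd ρ σ v.2 w.2 x)]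
  rw [finsum_mem_eq_finite_toFinset_sum _ (Set.toFinite _),
    finsum_mem_eq_finite_toFinset_sum _ (Set.toFinite _),
    finsum_mem_eq_finite_toFinset_sum _ (Set.toFinite _)]
  have e : (Set.toFinite (MulAction.orbit A ((g : G) : G ⧸ A) ×ˢ
        MulAction.orbit B ((h : H) : H ⧸ B))).toFinset =
      (Set.toFinite (MulAction.orbit A ((g : G) : G ⧸ A))).toFinset ×ˢ
        (Set.toFinite (MulAction.orbit B ((h : H) : H ⧸ B))).toFinset := by
    rw [Set.Finite.toFinset_prod]
  rw [e, Finset.sum_product, TensorProduct.sum_tmul]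
  refine Finset.sum_congr rfl fun a _ => ?_
  rw [TensorProduct.tmul_sum]

/-- The Hecke eigenvalues multiply: if `T_g v = c • v` and `T_h w = d • w` then
`T_{(g, h)} (v ⊗ w) = (c * d) • (v ⊗ w)`. -/
theorem heckeSMul_doubleCosetOp_tmul_eq_smul (g : G) (h : H)
    [Finite (MulAction.orbit A ((g : G) : G ⧸ A))] [Finite (MulAction.orbit B ((h : H) : H ⧸ B))]
    (v : invariants ρ A) (w : invariants σ B) {c d : k}
    (hc : heckeSMul ρ (doubleCosetOp k A g) v = c • v)
    (hd : heckeSMul σ (doubleCosetOp k B h) w = d • w) :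
    haveI := finite_orbit_prod A B g h
    (heckeSMul (extProd ρ σ) (doubleCosetOp k (A.prod B) (g, h))
        ⟨(v : V) ⊗ₜ[k] (w : W), tmul_mem_invariants ρ σ v.2 w.2⟩ : V ⊗[k] W) =
      (c * d) • ((v : V) ⊗ₜ[k] (w : W)) := by
  rw [heckeSMul_doubleCosetOp_tmul, hc, hd, Submodule.coe_smul, Submodule.coe_smul,
    TensorProduct.smul_tmul_smul]

end Summit.Ventures.HodgeRepro2.T5HeckeExternalTensor
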